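import Literature.NumberTheory.GaloisRepresentations.SteinbergArtinRep
import Literature.RepresentationTheory.Semisimple.CharpolySubquotient
import Mathlib
import HarnessLib

/-!
# The character of the augmentation representation: `tr (g | (k^X)⁰) = #Fix(g) − 1`

Stub `stub_augmentationCharacter` (S4) of the line `slope-free-polarized-limit` for the crux
`Summit.Langlands.Langlands.Theses.PicardMuOrdinary.IrregularClassicality`.

For a field `k` (of ANY characteristic), a group `G` acting on a nonempty finite set `X` and
`g ∈ G`, the trace of `g` on the augmentation submodule `(k^X)⁰ = ker (ε : k^X → k)` of the
permutation module `k^X` is `#{x ∈ X : g • x = x} − 1` (Serre, *Linear Representations of Finite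
Groups*, §2.3 Ex. 2.2 and Ex. 2.6 (a); Fulton–Harris §5.2).  The tree's
`Literature.NumberTheory.GaloisRepresentations.trace_augmentationRep` proves this under the extra
hypothesis that `#X` is invertible in `k` (via the `G`-equivariant projection onto `ker ε`); here
the hypothesis is removed.

Proof.  The short exact sequence `0 → ker ε → k^X →ε k → 0` (exact on the right because `X` is
nonempty, `ε e_x = 1`) is compatible with the endomorphisms `g|_{ker ε}`, `g`, `id_k` (the
augmentation is `G`-invariant, `augmentation_permRep`), so by the multiplicativity of the
characteristic polynomial along a short exact sequence
(`Literature.RepresentationTheory.Semisimple.LinearMap.charpoly_eq_mul_of_exact`, Bourbaki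
*Algèbre* III § 8 (31)) and `tr = −nextCoeff ∘ charpoly` (Mathlib
`Matrix.trace_eq_neg_charpoly_nextCoeff`, `Polynomial.Monic.nextCoeff_mul`) the trace is additive:
`tr (g | k^X) = tr (g | ker ε) + tr (id_k) = tr (g | ker ε) + 1`.  Finally `tr (g | k^X) = #Fix(g)`
(the permutation character counts fixed points, tree `trace_permRep`).
-/

set_option linter.dupNamespace false
set_option autoImplicit false

open Literature.NumberTheory.GaloisRepresentations
open Literature.RepresentationTheory.Semisimple

namespace Summit.Langlands.Langlands.Theorems.IrregularClassicality.SlopeFreePolarizedLimit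

/-! ## Linear algebra: the trace is additive along a short exact sequence -/

/-- `tr f = −nextCoeff (charpoly f)` for an endomorphism of a finite free module over a nontrivial
commutative ring (Mathlib's `Matrix.trace_eq_neg_charpoly_nextCoeff` in a chosen basis). -/
theorem trace_eq_neg_nextCoeff_charpoly {R : Type*} {M : Type*} [CommRing R] [Nontrivial R]
    [AddCommGroup M] [Module R M] [Module.Free R M] [Module.Finite R M] (f : M →ₗ[R] M) :
    LinearMap.trace R M f = -f.charpoly.nextCoeff := by
  rw [LinearMap.trace_eq_matrix_trace R (Module.Free.chooseBasis R M) f, LinearMap.charpoly_def]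
  exact Matrix.trace_eq_neg_charpoly_nextCoeff _

/-- **Additivity of the trace along a short exact sequence.**  If `0 → S' →i V →π Q' → 0` is a
short exact sequence of finite-dimensional `k`-vector spaces and `f_S`, `f`, `f_Q` are compatible
endomorphisms (`i ∘ f_S = f ∘ i`, `π ∘ f = f_Q ∘ π`), then `tr f = tr f_S + tr f_Q`
(from `charpoly f = charpoly f_S · charpoly f_Q`). -/
theorem trace_eq_add_of_exact {k : Type*} [Field k] {V : Type*} {S' : Type*} {Q' : Type*}
    [AddCommGroup V] [Module k V] [FiniteDimensional k V]
    [AddCommGroup S'] [Module k S'] [FiniteDimensional k S']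
    [AddCommGroup Q'] [Module k Q'] [FiniteDimensional k Q']
    (f : V →ₗ[k] V) (i : S' →ₗ[k] V) (π : V →ₗ[k] Q') (hi : Function.Injective i)
    (hπ : Function.Surjective π) (hex : LinearMap.range i = LinearMap.ker π)
    (fS : S' →ₗ[k] S') (fQ : Q' →ₗ[k] Q') (hS : i ∘ₗ fS = f ∘ₗ i) (hQ : π ∘ₗ f = fQ ∘ₗ π) :
    LinearMap.trace k V f = LinearMap.trace k S' fS + LinearMap.trace k Q' fQ := by
  rw [trace_eq_neg_nextCoeff_charpoly f, trace_eq_neg_nextCoeff_charpoly fS,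
    trace_eq_neg_nextCoeff_charpoly fQ,
    LinearMap.charpoly_eq_mul_of_exact f i π hi hπ hex fS fQ hS hQ,
    Polynomial.Monic.nextCoeff_mul (LinearMap.charpoly_monic _) (LinearMap.charpoly_monic _),
    neg_add]

/-- **Trace along an invariant subspace and its quotient**: for an `f`-invariant subspace `p` of a
finite-dimensional `V`, `tr f = tr (f|_p) + tr (f mod p)`. -/
theorem trace_eq_trace_restrict_add_trace_mapQ {k : Type*} [Field k] {V : Type*}
    [AddCommGroup V] [Module k V] [FiniteDimensional k V] (f : V →ₗ[k] V) (p : Submodule k V)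
    (hp : p ≤ p.comap f) :
    LinearMap.trace k V f =
      LinearMap.trace k p (f.restrict (p := p) (q := p) fun _ hx => hp hx) +
        LinearMap.trace k (V ⧸ p) (p.mapQ p f hp) := by
  rw [trace_eq_neg_nextCoeff_charpoly f, trace_eq_neg_nextCoeff_charpoly (f.restrict _),
    trace_eq_neg_nextCoeff_charpoly (p.mapQ p f hp),
    LinearMap.charpoly_eq_charpoly_restrict_mul_charpoly_mapQ f p hp,
    Polynomial.Monic.nextCoeff_mul (LinearMap.charpoly_monic _) (LinearMap.charpoly_monic _),
    neg_add]

/-! ## The augmentation sequence `0 → (k^X)⁰ → k^X → k → 0` -/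

/-- The augmentation `ε : k^X → k` is surjective when `X` is nonempty (`ε (c • e_x) = c`). -/
theorem augmentation_surjective (k : Type*) [CommRing k] (X : Type*) [Nonempty X] :
    Function.Surjective (augmentation k X) := fun c =>
  ⟨Finsupp.single (Classical.arbitrary X) c, augmentation_single k _ c⟩

/-- Exactness in the middle: the image of `(k^X)⁰ ↪ k^X` is `ker ε`. -/
theorem range_subtype_augmentationSubmodule (k : Type*) [CommRing k] (X : Type*) :
    LinearMap.range (augmentationSubmodule k X).subtype = LinearMap.ker (augmentation k X) :=
  Submodule.range_subtype _

/-- The inclusion `(k^X)⁰ ↪ k^X` intertwines `g|_{(k^X)⁰}` and `g`. -/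
theorem subtype_comp_augmentationRep (k : Type*) [CommRing k] (G : Type*) [Group G] (X : Type*)
    [MulAction G X] (g : G) :
    (augmentationSubmodule k X).subtype ∘ₗ (augmentationRep k G X g : _ →ₗ[k] _) =
      permRep k G X g ∘ₗ (augmentationSubmodule k X).subtype :=
  LinearMap.ext fun _ => rfl

/-- The augmentation intertwines `g` and the identity of `k` (`ε` is `G`-invariant). -/
theorem augmentation_comp_permRep (k : Type*) [CommRing k] (G : Type*) [Group G] (X : Type*)
    [MulAction G X] (g : G) :
    augmentation k X ∘ₗ permRep k G X g = LinearMap.id ∘ₗ augmentation k X :=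
  LinearMap.ext fun f => augmentation_permRep k g f

/-- **`tr (g | k^X) = tr (g | (k^X)⁰) + 1`** for a nonempty finite `G`-set `X` over a field `k`
(additivity of the trace along `0 → (k^X)⁰ → k^X → k → 0`, with `g` acting trivially on `k`). -/
theorem trace_permRep_eq_trace_augmentationRep_add_one (k : Type*) [Field k] (G : Type*)
    [Group G] (X : Type*) [Finite X] [Nonempty X] [MulAction G X] (g : G) :
    LinearMap.trace k (X →₀ k) (permRep k G X g) =
      LinearMap.trace k (augmentationSubmodule k X) (augmentationRep k G X g) + 1 := by
  have h : LinearMap.trace k (X →₀ k) (permRep k G X g) =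
      LinearMap.trace k (augmentationSubmodule k X) (augmentationRep k G X g) +
        LinearMap.trace k k LinearMap.id :=
    trace_eq_add_of_exact (S' := augmentationSubmodule k X) (Q' := k) (permRep k G X g)
      (augmentationSubmodule k X).subtype (augmentation k X)
      (augmentationSubmodule k X).injective_subtype (augmentation_surjective k X)
      (range_subtype_augmentationSubmodule k X) (augmentationRep k G X g) LinearMap.id
      (subtype_comp_augmentationRep k G X g) (augmentation_comp_permRep k G X g)
  rw [h, LinearMap.trace_id, Module.finrank_self, Nat.cast_one]

/-- **Character of the augmentation representation, all characteristics**: for a field `k`, a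
group `G` acting on a nonempty finite set `X` and `g ∈ G`,
`tr (g | (k^X)⁰) = #{x ∈ X : g • x = x} − 1` (Serre, *Linear Representations*, §2.3 Ex. 2.2,
Ex. 2.6 (a); Fulton–Harris §5.2).  Compare the tree's `trace_augmentationRep`, which assumes
`#X` invertible in `k`. -/
theorem trace_augmentationRep_eq_card_fixed_sub_one (k : Type*) [Field k] (G : Type*) [Group G]
    (X : Type*) [Finite X] [Nonempty X] [MulAction G X] (g : G) :
    LinearMap.trace k (augmentationSubmodule k X) (augmentationRep k G X g) =
      (Nat.card {x : X // g • x = x} : k) - 1 := by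
  rw [← trace_permRep (k := k) g, trace_permRep_eq_trace_augmentationRep_add_one k G X g,
    add_sub_cancel_right]

/-! ## The stub -/

/-- **Stub S4 — the augmentation character** (registered signature of the line
`slope-free-polarized-limit`): for a field `k` of any characteristic, a group `G` acting on a
nonempty finite set `X` and `g ∈ G`, the trace of `g` on the sum-zero module `(k^X)⁰` is
`#Fix(g) − 1` (Serre §2.3 Ex. 2.2, Ex. 2.6 (a); Fulton–Harris §5.2). -/
theorem stub_augmentationCharacter :
    ∀ (k : Type) [Field k] (G : Type) [Group G] (X : Type) [Fintype X] [DecidableEq X] [Nonempty X]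
      [MulAction G X] (g : G),
      LinearMap.trace k (augmentationSubmodule k X) (augmentationRep k G X g) =
        (Nat.card {x : X // g • x = x} : k) - 1 := by
  intro k _ G _ X _ _ _ _ g
  exact trace_augmentationRep_eq_card_fixed_sub_one k G X g

end Summit.Langlands.Langlands.Theorems.IrregularClassicality.SlopeFreePolarizedLimit
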